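import Mathlib
import Literature.MathematicalPhysics.QuantumFieldTheory.Balaban1983to89.B6Prop23TwoLevel
import Literature.MathematicalPhysics.QuantumFieldTheory.Balaban1983to89.B6Prop23MajorantInput

/-!
# `Balaban1983to89.B6Prop23TwoLevelInputs` — the three located-input edges of Proposition 2.3 (change of domain,
(2.68) from the block majorants, (2.67)₀ read off the print) re-run on the TWO-LEVEL certificate
`…B6Prop23TwoLevel.prop23_assembled_twoLevel`: the theorems `B6Prop23DomainInput.prop23_assembled_fine`,
`B6Prop23KernelInput.prop23_assembled_rw`, `B6Prop23MajorantInput.prop23_assembled_p22` WITHOUT the single-level-support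
hypothesis `hlev` (B6 = T. Bałaban, *Propagators and renormalization transformations for lattice gauge theories. II*,
Commun. Math. Phys. **96**, 223–250 (1984) [Balaban1984PropagatorsII]).

CITATION HEADER (lean-in-tree rule 2026-08-18).  Cell `pub-balaban`, unit `b2b-balaban-b06-g14` (paper sub-cell B06,
gen 14 — the owner lineage of `…B6Prop23Assembled`, `…B6Prop23DomainInput`, `…B6Prop23KernelInput`,
`…B6Prop23MajorantInput`, `…B6Prop23TwoLevel`, which this NEW LEAF imports and does not modify).  Source:
doi:10.1007/bf01240221, held `paper:balaban1984-cmp96-propagators-rt-ii`; journal page = PDF page + 222; the one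
quotation below (p. 235) was read from the page render `b2b-balaban-ref1/pages/1984-cmp96-propagators-rt-II/1984-cmp96-
propagators-rt-II-p013-x2.png` AS AN IMAGE (gen 14, for `…B6Prop23TwoLevel`, re-used here unchanged).  Cell rows GAPS
C-b06g14-2 (this module), C-b06g14-1 and DIVERGENCE D-b06.33 (the two-level reading); journal claim
PROP23-TWO-LEVEL-INPUTS.

THE POINT.  `…B6Prop23TwoLevel` (gen 14) re-proved the Proposition 2.3 certificate `B6Prop23Assembled.prop23_assembled`
without its hypothesis `hlev` "supp h_□ lies on ONE level of 𝔅" — the printed p. 235 allows the enlarged cube to meet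
two levels: *"We assume that either □̃ ⊂ B^j(Λ_j), or it intersects B^{j+1}(Λ_{j+1}) also."* — at the price κ₄ ↦ κ₄ᵀᴸ =
L⁴κ₄ in the threshold constant (K₂₈₅ ↦ K₂₈₅ᵀᴸ = `B6Prop23TwoLevel.K285TL`).  The three DERIVED-INPUT forms of
Proposition 2.3 landed by gens 9–11 (`prop23_assembled_fine`: the change-of-domain input `hdom` discharged from the
fine-lattice line-3 chain; `prop23_assembled_rw`: the (2.68)-inputs `hX`, `hXw` discharged from the block majorants of
G′, G′(□̃); `prop23_assembled_p22`: those majorants read off entry 0 of the printed (2.67)) each call `prop23_assembled`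
and therefore still carry `hlev`.  THIS MODULE re-runs the three edges on the two-level certificate: the statements
below are those three theorems VERBATIM with the binder `hlev` deleted and `K285` replaced by `K285TL` in the threshold
`hKM`; the proofs are the upstream proofs with `prop23_assembled` replaced by `prop23_assembled_twoLevel` — the located
lemmas `B6Prop23DomainInput.hdom_family`, `B6Prop23KernelInput.kernel_bound_of_majorant_rate`,
`B6Prop23MajorantInput.hasMajorant_of_entry0` are invoked BY NAME (none of them involves `hlev`), nothing is restated.
So the whole located chain of B6 Sect. B in the tree — (2.67)₀ ⟹ block majorants ⟹ (2.68), fine-lattice line 3 ⟹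
change of domain ⟹ (2.85) ⟹ Lemma 2.1 ⟹ (2.86)–(2.87) — now holds for partitions whose cubes meet two adjacent levels,
as printed.

WHAT THIS MODULE PROVES (kernel-checked; no `sorry`, no axiom beyond Lean's three; no new definition):
1. §1 `threshold_of_twoLevel` — the two-level threshold «M large enough» (2K₂₈₅ᵀᴸc ≤ M) implies the single-level one
   (2K₂₈₅c ≤ M) (`B6Prop23TwoLevel.K285_le_K285TL`): on single-level partitions both the upstream theorems and the
   twins below apply, the twins asking the (L⁴-)larger M.
2. §2 `prop23_assembled_fine_twoLevel` — `B6Prop23DomainInput.prop23_assembled_fine` minus `hlev`;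
   `prop23_assembled_rw_twoLevel` — `B6Prop23KernelInput.prop23_assembled_rw` minus `hlev`;
   `prop23_assembled_p22_twoLevel` — `B6Prop23MajorantInput.prop23_assembled_p22` minus `hlev`.  Conclusions verbatim:
   the two-sided inverse G = (Q′G′²Q′*)^{−1} in the pairing (2.69), (2.86) G = C + G·R, uniqueness, and (2.87) with the
   SAME O(1) = 2n₀B_C L^{d+4}c.

HONEST SCOPE.  Exactly that of the upstream theorems and of `…B6Prop23TwoLevel`: every analytic input of B6 Sect. B
stays a located hypothesis of the printed shape ((2.60) `h260`, the (2.61) profile `hPr`, `Ineq261With`∕`Ineq263With`,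
the block majorants or the (2.67)₀ clauses, the cut algebra and commutator-zone majorants of the □̃_i, the Q′-data, the
C_□ data (2.81)∕(2.70), the partition data, the thresholds `hthr`∕`hKM`, the depth comparison `hM₀`); three-level
supports remain excluded by the cube fact `hcube` itself (a cube has sites of scales j_□, j_□ + 1 only); the factor L⁸
inside κ₄ᵀᴸ is not claimed optimal.  NOT touched: the summit `YangMillsMassGap` (B6 is d = 3 renormalization
technology); no Summits-side statement changes.  Consistency of the hypothesis packages: the located lemmas have their
one-point models upstream (`B6Prop23DomainInput.hdom_of_line3_pt`, `B6Prop23KernelInput.kernel_bound_pt`,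
`B6Prop23MajorantInput.locGeo_majorant`) and the two-level certificate its two-level model
`B6Prop23TwoLevel.prop23Printed_twoLevel`; as upstream, no joint model of the re-assembled packages is claimed.
-/

namespace Literature.MathematicalPhysics.QuantumFieldTheory.Balaban1983to89.B6Prop23TwoLevelInputs

open Finset Real
open B4Sect5Torus (IsPseudoDist)
open B6DomainChange (Profile)
open B6RandomWalk (HasMajorant BlockSupp Ineq260)
open B6RandomWalkHom (HasMajorantHom)
open B6DomainMajorant (Ctot Ctot_nonneg)
open B6Expansion282 (kerOp kerOp_apply locOp Cglued R282)
open B6Prop23Chain (mat)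
open B6Lemma21Repaired (Ineq261With Ineq263With)
open B6Ineq268 (LevelSep)
open B6Prop23Assembled (K285)
open B6Prop23TwoLevel (K285TL K285_le_K285TL prop23_assembled_twoLevel)
open B6Prop23DomainInput (hdom_family abs_le_one_of_zero_or_one abs_le_one_of_sum_sq)
open B6Prop23KernelInput (kernel_bound_of_majorant_rate)
open B6Prop23MajorantInput (hasMajorant_of_entry0)

/-! ## §1  The threshold «M large enough»: two-level ⟹ single-level -/

section Threshold

variable {g : B6.Geometry}

/-- The two-level threshold implies the single-level one: 2K₂₈₅ᵀᴸc ≤ M ⟹ 2K₂₈₅c ≤ M (K₂₈₅ ≤ K₂₈₅ᵀᴸ, c ≥ 0), i.e. the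
twins below ask MORE of «M large enough» than `B6Prop23Assembled.prop23_assembled` and its three derived-input forms.
[cite: Balaban1984PropagatorsII, Proposition 2.3 p.238 «M large enough»; (2.85) p.238] -/
theorem threshold_of_twoLevel (hL : 1 ≤ g.L) {d n₀ : ℕ} {s δ₀ cσ c₃ mg BX BD BC c : ℝ} (hδ₀ : 0 < δ₀)
    (hmg : 0 < mg) (hcσ : 0 ≤ cσ) (hBX : 0 ≤ BX) (hBC : 0 ≤ BC) (hc : 0 ≤ c)
    (hKM : 2 * K285TL g d n₀ s δ₀ cσ c₃ mg BX BD BC * c ≤ g.M) :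
    2 * K285 g d n₀ s δ₀ cσ c₃ mg BX BD BC * c ≤ g.M :=
  le_trans (mul_le_mul_of_nonneg_right
    (mul_le_mul_of_nonneg_left (K285_le_K285TL hL hδ₀ hmg hcσ hBX hBC) zero_le_two) hc) hKM

end Threshold

/-! ## §2  The three derived-input forms of Proposition 2.3, two-level supports -/

section Reassembly

variable {g : B6.Geometry} [DecidableEq g.Site] {X : Type} {ι : Type} [Fintype ι] [DecidableEq ι]

/-- **PROPOSITION 2.3 WITH THE CHANGE-OF-DOMAIN INPUT DISCHARGED, TWO-LEVEL SUPPORTS**: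
`B6Prop23DomainInput.prop23_assembled_fine` (p. 238 before (2.85) ⟹ (2.85) ⟹ Lemma 2.1 ⟹ (2.86)–(2.87); rate
δ₀ := (δ − α′δ₀)/3, B_D := c_Qc_{Q*}L²C_tot, `hdom` discharged by `B6Prop23DomainInput.hdom_family`) WITHOUT the
single-level-support hypothesis `hlev` — p. 235 *"We assume that either □̃ ⊂ B^j(Λ_j), or it intersects B^{j+1}(Λ_{j+1})
also."* — the certificate being `B6Prop23TwoLevel.prop23_assembled_twoLevel`; threshold constant K₂₈₅ ↦ K₂₈₅ᵀᴸ in `hKM`;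
every other hypothesis and the conclusion (inverse of Q′G′²Q′* in the pairing (2.69), (2.86), uniqueness, (2.87))
VERBATIM those of `prop23_assembled_fine`. [cite: Balaban1984PropagatorsII, Proposition 2.3 (2.85)–(2.87) p.238;
p.235 before (2.70)] -/
theorem prop23_assembled_fine_twoLevel (d : ℕ) (hρ : IsPseudoDist g.dist) (hsep : B6Ineq268.LevelSep g) (hL : 1 ≤ g.L)
    (hη : 0 < g.eta) (hM : 0 < g.M) (hRM : 0 ≤ g.R * g.M)
    -- the fine-lattice side: blocks, (2.60), the (2.61) profile, the located size condition
    (blk : X → g.Site) {δ₀ α' : ℝ} (h260 : B6RandomWalk.Ineq260 g δ₀ α') {K : ℝ → ℝ}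
    (hK : ∀ a, 0 < a → 0 ≤ K a) (hPr : Profile g.dist (fun a : g.Site => a) K) (hα' : 0 ≤ α' * δ₀)
    (hsize : g.L ^ 2 * Real.exp (-(α' * δ₀ * (g.R * g.M))) ≤ 1)
    {δ B₁ θ : ℝ} (hκδ : α' * δ₀ < δ) (hB₁ : 0 ≤ B₁) (hθ : 0 ≤ θ)
    -- the constants of the assembled Prop. 2.3 (its δ₀ is (δ − α′δ₀)/3 here)
    {δ₁ σ cσ c c₃ s mg BX BC : ℝ} (hδ₁ : 0 ≤ δ₁) (hsplit : δ₁ + σ * ((δ - α' * δ₀) / 3) ≤ (δ - α' * δ₀) / 3 / 4)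
    (h261σ : Ineq261With cσ g ((δ - α' * δ₀) / 3) σ)
    (hthr : g.L ^ 4 ≤ Real.exp (1 / 8 * ((δ - α' * δ₀) / 3) * g.R * g.M))
    (h261 : Ineq261With c g δ₁ (1 / 2)) (h263 : Ineq263With c g δ₁ (1 / 2)) (hc : 0 ≤ c)
    (hc₃ : 0 < c₃) (hs : 0 ≤ s) (hmg : 0 < mg) (hBX : 0 ≤ BX) (hBC : 0 ≤ BC)
    -- the cubes □_i = pf i, the partition of unity h_i = hf i, the kernels X, X̃_i, C_i in the pairing (2.69)
    {pf hf : ι → g.Site → ℝ} {js : ι → ℕ} {n₀ : ℕ} {Xk : g.Site → g.Site → ℝ}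
    {Xwk Ck : ι → g.Site → g.Site → ℝ}
    (hover : ∀ y, (Finset.univ.filter fun i => hf i y ≠ 0).card ≤ n₀)
    (hpf01 : ∀ i y, pf i y = 0 ∨ pf i y = 1) (hph : ∀ i y, pf i y * hf i y = hf i y)
    (h236 : ∀ y, ∑ i, hf i y ^ 2 = 1) (hLip : ∀ i y y'', |hf i y - hf i y''| ≤ s / g.M * g.dist y y'')
    (hcube : ∀ i y, pf i y ≠ 0 → js i ≤ g.scale y ∧ g.scale y ≤ js i + 1)
    (hgap : ∀ i y y'', pf i y = 0 → hf i y'' ≠ 0 → mg * g.M ≤ g.dist y y'')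
    (hX : ∀ y y'', |g.len y'' ^ d * Xk y y''| ≤
      BX * g.len y ^ 4 * Real.exp (-(1 / 2 * ((δ - α' * δ₀) / 3) * g.dist y y'')))
    (hXw : ∀ i y y'', |g.len y'' ^ d * Xwk i y y''| ≤
      BX * g.len y ^ 4 * Real.exp (-(1 / 2 * ((δ - α' * δ₀) / 3) * g.dist y y'')))
    (h281 : ∀ i y y', pf i y ≠ 0 → pf i y' ≠ 0 →
      |Ck i y y'| ≤ BC / (g.L ^ js i * g.eta) ^ (d + 4) * Real.exp (-(δ₁ * g.dist y y')))
    (hCk0 : ∀ i y'' y', pf i y'' = 0 → Ck i y'' y' = 0)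
    (h270 : ∀ i, locOp (fun i => B6Expansion282.mulOp (pf i)) (fun i => kerOp (fun z => g.len z ^ d) (Xwk i)) i *
      kerOp (fun z => g.len z ^ d) (Ck i) * B6Expansion282.mulOp (hf i) = B6Expansion282.mulOp (hf i))
    -- the fine-lattice data of each cube: zone N_i, cut-off χ_i, D_i, G′(□̃_i) = Gw i; G′ = G, Q′ = Qp, Q′* = Qs
    (N : ι → Finset g.Site) (hN : ∀ i, (N i).Nonempty)
    {G : Module.End ℝ (X → ℝ)} {Dop Gw : ι → Module.End ℝ (X → ℝ)} {χ : ι → X → ℝ}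
    (hχ1 : ∀ i x, |χ i x| ≤ 1)
    (hpfχ : ∀ i x, pf i (blk x) * χ i x = pf i (blk x)) (hhχ : ∀ i x, χ i x * hf i (blk x) = hf i (blk x))
    (hχN : ∀ i x, blk x ∉ N i → χ i x = 1)
    (hGD : ∀ i, G * Dop i = 1) (hDG : ∀ i, Dop i * G = 1)
    (hχGw : ∀ i, B9Thm37Sum.mulOp (χ i) * Dop i * Gw i = B9Thm37Sum.mulOp (χ i))
    (hGwχ : ∀ i, Gw i * Dop i * B9Thm37Sum.mulOp (χ i) = B9Thm37Sum.mulOp (χ i))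
    (hG : HasMajorant blk G (fun a b => B₁ * g.len a ^ 2 * Real.exp (-(δ * g.dist a b))))
    (hGw : ∀ i, HasMajorant blk (Gw i) (fun a b => B₁ * g.len a ^ 2 * Real.exp (-(δ * g.dist a b))))
    (hKGw : ∀ i, HasMajorant blk ((B9Thm37Sum.mulOp (χ i) * Dop i - Dop i * B9Thm37Sum.mulOp (χ i)) * Gw i)
      (fun a b => (if a ∈ N i then θ else 0) * Real.exp (-(δ * g.dist a b))))
    (hKG : ∀ i, HasMajorant blk ((B9Thm37Sum.mulOp (χ i) * Dop i - Dop i * B9Thm37Sum.mulOp (χ i)) * G)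
      (fun a b => (if a ∈ N i then θ else 0) * Real.exp (-(δ * g.dist a b))))
    {M₀ : ℝ} (hpfdeep : ∀ i y, pf i y ≠ 0 → ∀ n ∈ N i, M₀ ≤ g.dist y n)
    (hhdeep : ∀ i y, hf i y ≠ 0 → ∀ n ∈ N i, M₀ ≤ g.dist y n)
    {Qp : (X → ℝ) →ₗ[ℝ] (g.Site → ℝ)} {Qs : (g.Site → ℝ) →ₗ[ℝ] (X → ℝ)} {cQ cQs : ℝ} (hcQ : 0 ≤ cQ)
    (hcQs : 0 ≤ cQs)
    (hQ : HasMajorantHom blk (fun y : g.Site => y) Qp (fun (a b : g.Site) => cQ * (if a = b then (1 : ℝ) else 0)))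
    (hQs : HasMajorantHom (fun y : g.Site => y) blk Qs (fun (a b : g.Site) => cQs * (if a = b then (1 : ℝ) else 0)))
    (hQχ : ∀ i, (B9Thm37Sum.mulOp (pf i) : Module.End ℝ (g.Site → ℝ)) ∘ₗ Qp =
      Qp ∘ₗ (B9Thm37Sum.mulOp (pf i ∘ blk) : Module.End ℝ (X → ℝ)))
    (hQsh : ∀ i, Qs ∘ₗ (B9Thm37Sum.mulOp (hf i) : Module.End ℝ (g.Site → ℝ)) =
      (B9Thm37Sum.mulOp (hf i ∘ blk) : Module.End ℝ (X → ℝ)) ∘ₗ Qs)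
    -- the dictionary (definitions of X, X̃_i as the (2.69)-kernels of Q′G′²Q′*, Q′G′(□̃_i)²Q′*) and the depth
    (hXdef : kerOp (fun z => g.len z ^ d) Xk = Qp ∘ₗ (G * G) ∘ₗ Qs)
    (hXwdef : ∀ i, kerOp (fun z => g.len z ^ d) (Xwk i) = Qp ∘ₗ (Gw i * Gw i) ∘ₗ Qs)
    (hM₀ : c₃ * g.M ≤ (δ - α' * δ₀) / 3 * M₀)
    -- «M large enough», with B_D := c_Q c_{Q*} L² C_tot
    (hKM : 2 * K285TL g d n₀ s ((δ - α' * δ₀) / 3) cσ c₃ mg BX (cQ * cQs * (g.L ^ 2 * Ctot K B₁ θ (δ - α' * δ₀))) BC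
      * c ≤ g.M) :
    ∃ Ginv : Module.End ℝ (g.Site → ℝ),
      Ginv * kerOp (fun z => g.len z ^ d) Xk = 1 ∧ kerOp (fun z => g.len z ^ d) Xk * Ginv = 1 ∧
      Ginv = Cglued (fun i => B6Expansion282.mulOp (hf i)) (fun i => kerOp (fun z => g.len z ^ d) (Ck i)) +
        Ginv * R282 (kerOp (fun z => g.len z ^ d) Xk) (fun i => B6Expansion282.mulOp (pf i))
          (fun i => kerOp (fun z => g.len z ^ d) (Xwk i)) (fun i => B6Expansion282.mulOp (hf i))
          (fun i => kerOp (fun z => g.len z ^ d) (Ck i)) ∧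
      (∀ G' : Module.End ℝ (g.Site → ℝ), G' * kerOp (fun z => g.len z ^ d) Xk = 1 → G' = Ginv) ∧
      ∀ y y', |mat Ginv y y' / g.len y' ^ d| ≤
        2 * (n₀ * (BC * g.L ^ (d + 4))) * c * g.len y ^ (-(4 : ℝ)) * g.len y' ^ (-(d : ℝ)) *
          Real.exp (-(δ₁ / 2 * g.dist y y')) := by
  have hδA : 0 < (δ - α' * δ₀) / 3 := by linarith
  have hBD : 0 ≤ cQ * cQs * (g.L ^ 2 * Ctot K B₁ θ (δ - α' * δ₀)) :=
    mul_nonneg (mul_nonneg hcQ hcQs)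
      (mul_nonneg (pow_nonneg (le_trans zero_le_one hL) 2) (Ctot_nonneg hK hB₁ hθ (sub_pos.mpr hκδ)))
  have hpf1 : ∀ i y, |pf i y| ≤ 1 := fun i => abs_le_one_of_zero_or_one (hpf01 i)
  have hh1 : ∀ i y, |hf i y| ≤ 1 := abs_le_one_of_sum_sq h236
  exact prop23_assembled_twoLevel d hρ.triangle hρ.zero hρ.nonneg hsep hL hη hM hRM hδA hδ₁ hsplit h261σ hthr h261
    h263 hc hc₃ hs hmg hBX hBD hBC hover hpf01 hph h236 hLip hcube hgap hX hXw
    (hdom_family blk hρ h260 hK hPr hα' hRM hL hsize N hN hκδ hB₁ hθ hχ1 hpf1 hh1 hpfχ hhχ hχN hGD hDG hχGw hGwχ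
      hG hGw hKGw hKG hpfdeep hhdeep hcQ hcQs hQ hQs hQχ hQsh d hXdef hXwdef hM₀)
    h281 hCk0 h270 hKM

/-- **PROPOSITION 2.3 FROM THE RANDOM-WALK MAJORANTS, TWO-LEVEL SUPPORTS**: `B6Prop23KernelInput.prop23_assembled_rw`
(p. 235 (2.67) ⇒ (2.68) + p. 238 ⇒ (2.85) ⇒ Lemma 2.1 ⇒ (2.86)–(2.87); the (2.68)-inputs `hX`, `hXw` discharged by
`B6Prop23KernelInput.kernel_bound_of_majorant_rate` from the block majorants `hG`, `hGw i`, B_X := c_Qc_{Q*}B₁²L²K(δ/2))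
WITHOUT the single-level-support hypothesis `hlev` (p. 235 *"or it intersects B^{j+1}(Λ_{j+1}) also"*), run on
`prop23_assembled_fine_twoLevel`; threshold constant K₂₈₅ ↦ K₂₈₅ᵀᴸ in `hKM`; every other hypothesis and the conclusion
VERBATIM those of `prop23_assembled_rw`. [cite: Balaban1984PropagatorsII, Proposition 2.3 (2.85)–(2.87) p.238; (2.68)
p.235] -/
theorem prop23_assembled_rw_twoLevel (d : ℕ) (hρ : IsPseudoDist g.dist) (hsep : LevelSep g) (hL : 1 ≤ g.L)
    (hη : 0 < g.eta) (hM : 0 < g.M) (hRM : 0 ≤ g.R * g.M)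
    -- the fine-lattice side: blocks, (2.60), the (2.61) profile, the located size condition
    (blk : X → g.Site) {δ₀ α' : ℝ} (h260 : B6RandomWalk.Ineq260 g δ₀ α') {K : ℝ → ℝ}
    (hK : ∀ a, 0 < a → 0 ≤ K a) (hPr : Profile g.dist (fun a : g.Site => a) K) (hα' : 0 ≤ α' * δ₀)
    (hsize : g.L ^ 2 * Real.exp (-(α' * δ₀ * (g.R * g.M))) ≤ 1)
    {δ B₁ θ : ℝ} (hκδ : α' * δ₀ < δ) (hB₁ : 0 ≤ B₁) (hθ : 0 ≤ θ)
    -- the constants of the assembled Prop. 2.3 (its δ₀ is (δ − α′δ₀)/3 here)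
    {δ₁ σ cσ c c₃ s mg BC : ℝ} (hδ₁ : 0 ≤ δ₁) (hsplit : δ₁ + σ * ((δ - α' * δ₀) / 3) ≤ (δ - α' * δ₀) / 3 / 4)
    (h261σ : Ineq261With cσ g ((δ - α' * δ₀) / 3) σ)
    (hthr : g.L ^ 4 ≤ Real.exp (1 / 8 * ((δ - α' * δ₀) / 3) * g.R * g.M))
    (h261 : Ineq261With c g δ₁ (1 / 2)) (h263 : Ineq263With c g δ₁ (1 / 2)) (hc : 0 ≤ c)
    (hc₃ : 0 < c₃) (hs : 0 ≤ s) (hmg : 0 < mg) (hBC : 0 ≤ BC)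
    -- the cubes □_i = pf i, the partition of unity h_i = hf i, the kernels X, X̃_i, C_i in the pairing (2.69)
    {pf hf : ι → g.Site → ℝ} {js : ι → ℕ} {n₀ : ℕ} {Xk : g.Site → g.Site → ℝ}
    {Xwk Ck : ι → g.Site → g.Site → ℝ}
    (hover : ∀ y, (Finset.univ.filter fun i => hf i y ≠ 0).card ≤ n₀)
    (hpf01 : ∀ i y, pf i y = 0 ∨ pf i y = 1) (hph : ∀ i y, pf i y * hf i y = hf i y)
    (h236 : ∀ y, ∑ i, hf i y ^ 2 = 1) (hLip : ∀ i y y'', |hf i y - hf i y''| ≤ s / g.M * g.dist y y'')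
    (hcube : ∀ i y, pf i y ≠ 0 → js i ≤ g.scale y ∧ g.scale y ≤ js i + 1)
    (hgap : ∀ i y y'', pf i y = 0 → hf i y'' ≠ 0 → mg * g.M ≤ g.dist y y'')
    (h281 : ∀ i y y', pf i y ≠ 0 → pf i y' ≠ 0 →
      |Ck i y y'| ≤ BC / (g.L ^ js i * g.eta) ^ (d + 4) * Real.exp (-(δ₁ * g.dist y y')))
    (hCk0 : ∀ i y'' y', pf i y'' = 0 → Ck i y'' y' = 0)
    (h270 : ∀ i, locOp (fun i => B6Expansion282.mulOp (pf i)) (fun i => kerOp (fun z => g.len z ^ d) (Xwk i)) i *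
      kerOp (fun z => g.len z ^ d) (Ck i) * B6Expansion282.mulOp (hf i) = B6Expansion282.mulOp (hf i))
    -- the fine-lattice data of each cube: zone N_i, cut-off χ_i, D_i, G′(□̃_i) = Gw i; G′ = G, Q′ = Qp, Q′* = Qs
    (N : ι → Finset g.Site) (hN : ∀ i, (N i).Nonempty)
    {G : Module.End ℝ (X → ℝ)} {Dop Gw : ι → Module.End ℝ (X → ℝ)} {χ : ι → X → ℝ}
    (hχ1 : ∀ i x, |χ i x| ≤ 1)
    (hpfχ : ∀ i x, pf i (blk x) * χ i x = pf i (blk x)) (hhχ : ∀ i x, χ i x * hf i (blk x) = hf i (blk x))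
    (hχN : ∀ i x, blk x ∉ N i → χ i x = 1)
    (hGD : ∀ i, G * Dop i = 1) (hDG : ∀ i, Dop i * G = 1)
    (hχGw : ∀ i, B9Thm37Sum.mulOp (χ i) * Dop i * Gw i = B9Thm37Sum.mulOp (χ i))
    (hGwχ : ∀ i, Gw i * Dop i * B9Thm37Sum.mulOp (χ i) = B9Thm37Sum.mulOp (χ i))
    (hG : HasMajorant blk G (fun a b => B₁ * g.len a ^ 2 * Real.exp (-(δ * g.dist a b))))
    (hGw : ∀ i, HasMajorant blk (Gw i) (fun a b => B₁ * g.len a ^ 2 * Real.exp (-(δ * g.dist a b))))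
    (hKGw : ∀ i, HasMajorant blk ((B9Thm37Sum.mulOp (χ i) * Dop i - Dop i * B9Thm37Sum.mulOp (χ i)) * Gw i)
      (fun a b => (if a ∈ N i then θ else 0) * Real.exp (-(δ * g.dist a b))))
    (hKG : ∀ i, HasMajorant blk ((B9Thm37Sum.mulOp (χ i) * Dop i - Dop i * B9Thm37Sum.mulOp (χ i)) * G)
      (fun a b => (if a ∈ N i then θ else 0) * Real.exp (-(δ * g.dist a b))))
    {M₀ : ℝ} (hpfdeep : ∀ i y, pf i y ≠ 0 → ∀ n ∈ N i, M₀ ≤ g.dist y n)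
    (hhdeep : ∀ i y, hf i y ≠ 0 → ∀ n ∈ N i, M₀ ≤ g.dist y n)
    {Qp : (X → ℝ) →ₗ[ℝ] (g.Site → ℝ)} {Qs : (g.Site → ℝ) →ₗ[ℝ] (X → ℝ)} {cQ cQs : ℝ} (hcQ : 0 ≤ cQ)
    (hcQs : 0 ≤ cQs)
    (hQ : HasMajorantHom blk (fun y : g.Site => y) Qp (fun (a b : g.Site) => cQ * (if a = b then (1 : ℝ) else 0)))
    (hQs : HasMajorantHom (fun y : g.Site => y) blk Qs (fun (a b : g.Site) => cQs * (if a = b then (1 : ℝ) else 0)))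
    (hQχ : ∀ i, (B9Thm37Sum.mulOp (pf i) : Module.End ℝ (g.Site → ℝ)) ∘ₗ Qp =
      Qp ∘ₗ (B9Thm37Sum.mulOp (pf i ∘ blk) : Module.End ℝ (X → ℝ)))
    (hQsh : ∀ i, Qs ∘ₗ (B9Thm37Sum.mulOp (hf i) : Module.End ℝ (g.Site → ℝ)) =
      (B9Thm37Sum.mulOp (hf i ∘ blk) : Module.End ℝ (X → ℝ)) ∘ₗ Qs)
    -- the dictionary (definitions of X, X̃_i as the (2.69)-kernels of Q′G′²Q′*, Q′G′(□̃_i)²Q′*) and the depth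
    (hXdef : kerOp (fun z => g.len z ^ d) Xk = Qp ∘ₗ (G * G) ∘ₗ Qs)
    (hXwdef : ∀ i, kerOp (fun z => g.len z ^ d) (Xwk i) = Qp ∘ₗ (Gw i * Gw i) ∘ₗ Qs)
    (hM₀ : c₃ * g.M ≤ (δ - α' * δ₀) / 3 * M₀)
    -- «M large enough», with B_X := c_Q c_{Q*} B₁² L² K(δ/2) and B_D := c_Q c_{Q*} L² C_tot
    (hKM : 2 * K285TL g d n₀ s ((δ - α' * δ₀) / 3) cσ c₃ mg (cQ * cQs * (B₁ ^ 2 * (g.L ^ 2 * K (δ / 2))))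
      (cQ * cQs * (g.L ^ 2 * Ctot K B₁ θ (δ - α' * δ₀))) BC * c ≤ g.M) :
    ∃ Ginv : Module.End ℝ (g.Site → ℝ),
      Ginv * kerOp (fun z => g.len z ^ d) Xk = 1 ∧ kerOp (fun z => g.len z ^ d) Xk * Ginv = 1 ∧
      Ginv = Cglued (fun i => B6Expansion282.mulOp (hf i)) (fun i => kerOp (fun z => g.len z ^ d) (Ck i)) +
        Ginv * R282 (kerOp (fun z => g.len z ^ d) Xk) (fun i => B6Expansion282.mulOp (pf i))
          (fun i => kerOp (fun z => g.len z ^ d) (Xwk i)) (fun i => B6Expansion282.mulOp (hf i))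
          (fun i => kerOp (fun z => g.len z ^ d) (Ck i)) ∧
      (∀ G' : Module.End ℝ (g.Site → ℝ), G' * kerOp (fun z => g.len z ^ d) Xk = 1 → G' = Ginv) ∧
      ∀ y y', |mat Ginv y y' / g.len y' ^ d| ≤
        2 * (n₀ * (BC * g.L ^ (d + 4))) * c * g.len y ^ (-(4 : ℝ)) * g.len y' ^ (-(d : ℝ)) *
          Real.exp (-(δ₁ / 2 * g.dist y y')) := by
  have hδ : 0 < δ := lt_of_le_of_lt hα' hκδ
  have hδA : (δ - α' * δ₀) / 3 ≤ δ := by linarith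
  have hL2 : g.L ^ 2 ≤ g.L ^ 4 := pow_le_pow_right₀ hL (by norm_num)
  have hexp : Real.exp (1 / 8 * ((δ - α' * δ₀) / 3) * g.R * g.M) ≤ Real.exp (1 / 4 * (2 * δ) * g.R * g.M) := by
    refine Real.exp_le_exp.mpr ?_
    have h1 : 1 / 8 * ((δ - α' * δ₀) / 3) ≤ 1 / 4 * (2 * δ) := by linarith
    calc 1 / 8 * ((δ - α' * δ₀) / 3) * g.R * g.M = 1 / 8 * ((δ - α' * δ₀) / 3) * (g.R * g.M) := by ring
      _ ≤ 1 / 4 * (2 * δ) * (g.R * g.M) := mul_le_mul_of_nonneg_right h1 hRM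
      _ = _ := by ring
  have hthr2 : g.L ^ 2 ≤ Real.exp (1 / 4 * (2 * δ) * g.R * g.M) := hL2.trans (hthr.trans hexp)
  have hBX : 0 ≤ cQ * cQs * (B₁ ^ 2 * (g.L ^ 2 * K (δ / 2))) := by
    have := hK (δ / 2) (by positivity); positivity
  exact prop23_assembled_fine_twoLevel d hρ hsep hL hη hM hRM blk h260 hK hPr hα' hsize hκδ hB₁ hθ hδ₁ hsplit h261σ
    hthr h261 h263 hc hc₃ hs hmg hBX hBC hover hpf01 hph h236 hLip hcube hgap
    (fun y y'' => kernel_bound_of_majorant_rate blk hρ hsep hL hη hRM hK hPr hδ hB₁ hthr2 hG hcQ hcQs hQ hQs d hXdef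
      hδA y y'')
    (fun i y y'' => kernel_bound_of_majorant_rate blk hρ hsep hL hη hRM hK hPr hδ hB₁ hthr2 (hGw i) hcQ hcQs hQ hQs d
      (hXwdef i) hδA y y'')
    h281 hCk0 h270 N hN hχ1 hpfχ hhχ hχN hGD hDG hχGw hGwχ hG hGw hKGw hKG hpfdeep hhdeep hcQ hcQs hQ hQs hQχ hQsh
    hXdef hXwdef hM₀ hKM

/-- **PROPOSITION 2.3 WITH ITS (2.67)-INPUTS READ OFF THE PRINT, TWO-LEVEL SUPPORTS**:
`B6Prop23MajorantInput.prop23_assembled_p22` (p. 234 (2.67) + p. 238 *"This estimate follows from the random walk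
representations (2.50) for the operators G′, G′(□̃)"* ⇒ (2.68) ⇒ (2.85) ⇒ Lemma 2.1 ⇒ (2.86)–(2.87); the block
majorants `hG`, `hGw i` discharged by `B6Prop23MajorantInput.hasMajorant_of_entry0` from the entry-0 clauses `h267`,
`h267w`) WITHOUT the single-level-support hypothesis `hlev` (p. 235 *"or it intersects B^{j+1}(Λ_{j+1}) also"*), run on
`prop23_assembled_rw_twoLevel`; threshold constant K₂₈₅ ↦ K₂₈₅ᵀᴸ in `hKM`; every other hypothesis and the conclusion
VERBATIM those of `prop23_assembled_p22`. [cite: Balaban1984PropagatorsII, Proposition 2.3 (2.85)–(2.87) p.238;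
Prop. 2.2 (2.67) p.234] -/
theorem prop23_assembled_p22_twoLevel (d : ℕ) (hρ : IsPseudoDist g.dist) (hsep : LevelSep g) (hL : 1 ≤ g.L)
    (hη : 0 < g.eta) (hM : 0 < g.M) (hRM : 0 ≤ g.R * g.M)
    -- the fine-lattice side: blocks, (2.60), the (2.61) profile, the located size condition
    (blk : X → g.Site) {δ₀ α' : ℝ} (h260 : B6RandomWalk.Ineq260 g δ₀ α') {K : ℝ → ℝ}
    (hK : ∀ a, 0 < a → 0 ≤ K a) (hPr : Profile g.dist (fun a : g.Site => a) K) (hα' : 0 ≤ α' * δ₀)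
    (hsize : g.L ^ 2 * Real.exp (-(α' * δ₀ * (g.R * g.M))) ≤ 1)
    {δ B₁ θ : ℝ} (hκδ : α' * δ₀ < δ) (hB₁ : 0 ≤ B₁) (hθ : 0 ≤ θ)
    -- the constants of the assembled Prop. 2.3 (its δ₀ is (δ − α′δ₀)/3 here)
    {δ₁ σ cσ c c₃ s mg BC : ℝ} (hδ₁ : 0 ≤ δ₁) (hsplit : δ₁ + σ * ((δ - α' * δ₀) / 3) ≤ (δ - α' * δ₀) / 3 / 4)
    (h261σ : Ineq261With cσ g ((δ - α' * δ₀) / 3) σ)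
    (hthr : g.L ^ 4 ≤ Real.exp (1 / 8 * ((δ - α' * δ₀) / 3) * g.R * g.M))
    (h261 : Ineq261With c g δ₁ (1 / 2)) (h263 : Ineq263With c g δ₁ (1 / 2)) (hc : 0 ≤ c)
    (hc₃ : 0 < c₃) (hs : 0 ≤ s) (hmg : 0 < mg) (hBC : 0 ≤ BC)
    -- the cubes □_i = pf i, the partition of unity h_i = hf i, the kernels X, X̃_i, C_i in the pairing (2.69)
    {pf hf : ι → g.Site → ℝ} {js : ι → ℕ} {n₀ : ℕ} {Xk : g.Site → g.Site → ℝ}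
    {Xwk Ck : ι → g.Site → g.Site → ℝ}
    (hover : ∀ y, (Finset.univ.filter fun i => hf i y ≠ 0).card ≤ n₀)
    (hpf01 : ∀ i y, pf i y = 0 ∨ pf i y = 1) (hph : ∀ i y, pf i y * hf i y = hf i y)
    (h236 : ∀ y, ∑ i, hf i y ^ 2 = 1) (hLip : ∀ i y y'', |hf i y - hf i y''| ≤ s / g.M * g.dist y y'')
    (hcube : ∀ i y, pf i y ≠ 0 → js i ≤ g.scale y ∧ g.scale y ≤ js i + 1)
    (hgap : ∀ i y y'', pf i y = 0 → hf i y'' ≠ 0 → mg * g.M ≤ g.dist y y'')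
    (h281 : ∀ i y y', pf i y ≠ 0 → pf i y' ≠ 0 →
      |Ck i y y'| ≤ BC / (g.L ^ js i * g.eta) ^ (d + 4) * Real.exp (-(δ₁ * g.dist y y')))
    (hCk0 : ∀ i y'' y', pf i y'' = 0 → Ck i y'' y' = 0)
    (h270 : ∀ i, locOp (fun i => B6Expansion282.mulOp (pf i)) (fun i => kerOp (fun z => g.len z ^ d) (Xwk i)) i *
      kerOp (fun z => g.len z ^ d) (Ck i) * B6Expansion282.mulOp (hf i) = B6Expansion282.mulOp (hf i))
    -- the fine-lattice data of each cube: zone N_i, cut-off χ_i, D_i, G′(□̃_i) = Gw i; G′ = G, Q′ = Qp, Q′* = Qs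
    (N : ι → Finset g.Site) (hN : ∀ i, (N i).Nonempty)
    {G : Module.End ℝ (X → ℝ)} {Dop Gw : ι → Module.End ℝ (X → ℝ)} {χ : ι → X → ℝ}
    (hχ1 : ∀ i x, |χ i x| ≤ 1)
    (hpfχ : ∀ i x, pf i (blk x) * χ i x = pf i (blk x)) (hhχ : ∀ i x, χ i x * hf i (blk x) = hf i (blk x))
    (hχN : ∀ i x, blk x ∉ N i → χ i x = 1)
    (hGD : ∀ i, G * Dop i = 1) (hDG : ∀ i, Dop i * G = 1)
    (hχGw : ∀ i, B9Thm37Sum.mulOp (χ i) * Dop i * Gw i = B9Thm37Sum.mulOp (χ i))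
    (hGwχ : ∀ i, Gw i * Dop i * B9Thm37Sum.mulOp (χ i) = B9Thm37Sum.mulOp (χ i))
    -- (2.67)₀ for G′ and for every G′(□̃_i), in the verbatim typing of `…B6` read through (ιL, hloc, hval):
    (ιL : g.Loc → X → ℝ)
    (hloc : ∀ (μ : X → ℝ) (y' : g.Site) (B : ℝ), BlockSupp blk μ y' B →
      ∃ lam, ιL lam = μ ∧ g.suppIn lam y' ∧ g.supNorm lam ≤ B)
    (E : g.Loc → g.Site → ℝ) (Ew : ι → g.Loc → g.Site → ℝ)
    (hval : ∀ lam x, |G (ιL lam) x| ≤ E lam (blk x)) (hvalw : ∀ i lam x, |Gw i (ιL lam) x| ≤ Ew i lam (blk x))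
    (h267 : ∀ lam y y', g.suppIn lam y' →
      E lam y ≤ B₁ * B6.pref4 (g.len y) 0 * Real.exp (-(δ * g.dist y y')) * g.supNorm lam)
    (h267w : ∀ i lam y y', g.suppIn lam y' →
      Ew i lam y ≤ B₁ * B6.pref4 (g.len y) 0 * Real.exp (-(δ * g.dist y y')) * g.supNorm lam)
    (hKGw : ∀ i, HasMajorant blk ((B9Thm37Sum.mulOp (χ i) * Dop i - Dop i * B9Thm37Sum.mulOp (χ i)) * Gw i)
      (fun a b => (if a ∈ N i then θ else 0) * Real.exp (-(δ * g.dist a b))))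
    (hKG : ∀ i, HasMajorant blk ((B9Thm37Sum.mulOp (χ i) * Dop i - Dop i * B9Thm37Sum.mulOp (χ i)) * G)
      (fun a b => (if a ∈ N i then θ else 0) * Real.exp (-(δ * g.dist a b))))
    {M₀ : ℝ} (hpfdeep : ∀ i y, pf i y ≠ 0 → ∀ n ∈ N i, M₀ ≤ g.dist y n)
    (hhdeep : ∀ i y, hf i y ≠ 0 → ∀ n ∈ N i, M₀ ≤ g.dist y n)
    {Qp : (X → ℝ) →ₗ[ℝ] (g.Site → ℝ)} {Qs : (g.Site → ℝ) →ₗ[ℝ] (X → ℝ)} {cQ cQs : ℝ} (hcQ : 0 ≤ cQ)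
    (hcQs : 0 ≤ cQs)
    (hQ : HasMajorantHom blk (fun y : g.Site => y) Qp (fun (a b : g.Site) => cQ * (if a = b then (1 : ℝ) else 0)))
    (hQs : HasMajorantHom (fun y : g.Site => y) blk Qs (fun (a b : g.Site) => cQs * (if a = b then (1 : ℝ) else 0)))
    (hQχ : ∀ i, (B9Thm37Sum.mulOp (pf i) : Module.End ℝ (g.Site → ℝ)) ∘ₗ Qp =
      Qp ∘ₗ (B9Thm37Sum.mulOp (pf i ∘ blk) : Module.End ℝ (X → ℝ)))
    (hQsh : ∀ i, Qs ∘ₗ (B9Thm37Sum.mulOp (hf i) : Module.End ℝ (g.Site → ℝ)) =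
      (B9Thm37Sum.mulOp (hf i ∘ blk) : Module.End ℝ (X → ℝ)) ∘ₗ Qs)
    -- the dictionary (definitions of X, X̃_i as the (2.69)-kernels of Q′G′²Q′*, Q′G′(□̃_i)²Q′*) and the depth
    (hXdef : kerOp (fun z => g.len z ^ d) Xk = Qp ∘ₗ (G * G) ∘ₗ Qs)
    (hXwdef : ∀ i, kerOp (fun z => g.len z ^ d) (Xwk i) = Qp ∘ₗ (Gw i * Gw i) ∘ₗ Qs)
    (hM₀ : c₃ * g.M ≤ (δ - α' * δ₀) / 3 * M₀)
    -- «M large enough», with B_X := c_Q c_{Q*} B₁² L² K(δ/2) and B_D := c_Q c_{Q*} L² C_tot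
    (hKM : 2 * K285TL g d n₀ s ((δ - α' * δ₀) / 3) cσ c₃ mg (cQ * cQs * (B₁ ^ 2 * (g.L ^ 2 * K (δ / 2))))
      (cQ * cQs * (g.L ^ 2 * Ctot K B₁ θ (δ - α' * δ₀))) BC * c ≤ g.M) :
    ∃ Ginv : Module.End ℝ (g.Site → ℝ),
      Ginv * kerOp (fun z => g.len z ^ d) Xk = 1 ∧ kerOp (fun z => g.len z ^ d) Xk * Ginv = 1 ∧
      Ginv = Cglued (fun i => B6Expansion282.mulOp (hf i)) (fun i => kerOp (fun z => g.len z ^ d) (Ck i)) +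
        Ginv * R282 (kerOp (fun z => g.len z ^ d) Xk) (fun i => B6Expansion282.mulOp (pf i))
          (fun i => kerOp (fun z => g.len z ^ d) (Xwk i)) (fun i => B6Expansion282.mulOp (hf i))
          (fun i => kerOp (fun z => g.len z ^ d) (Ck i)) ∧
      (∀ G' : Module.End ℝ (g.Site → ℝ), G' * kerOp (fun z => g.len z ^ d) Xk = 1 → G' = Ginv) ∧
      ∀ y y', |mat Ginv y y' / g.len y' ^ d| ≤
        2 * (n₀ * (BC * g.L ^ (d + 4))) * c * g.len y ^ (-(4 : ℝ)) * g.len y' ^ (-(d : ℝ)) *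
          Real.exp (-(δ₁ / 2 * g.dist y y')) :=
  prop23_assembled_rw_twoLevel d hρ hsep hL hη hM hRM blk h260 hK hPr hα' hsize hκδ hB₁ hθ hδ₁ hsplit h261σ hthr h261
    h263 hc hc₃ hs hmg hBC hover hpf01 hph h236 hLip hcube hgap h281 hCk0 h270 N hN hχ1 hpfχ hhχ hχN hGD hDG
    hχGw hGwχ (hasMajorant_of_entry0 blk G ιL E hB₁ hloc hval h267)
    (fun i => hasMajorant_of_entry0 blk (Gw i) ιL (Ew i) hB₁ hloc (hvalw i) (h267w i))
    hKGw hKG hpfdeep hhdeep hcQ hcQs hQ hQs hQχ hQsh hXdef hXwdef hM₀ hKM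

end Reassembly

end Literature.MathematicalPhysics.QuantumFieldTheory.Balaban1983to89.B6Prop23TwoLevelInputs
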